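/-
Copyright (c) 2026 the pub-hodgecm-mathlib formalisation cell (harness21).  Prover seat hodgecm-mathlib-LH4-p07 (g6), req620 Track A «(D-RAM) FOUR-FRAME» squad
(unit U3_Laws, (KSS²) road after the (R-22) «κS-RECUT»: (D₂) THE HEAD OF THE RE-LETTERED SIGNED TYPE-2 κ-STAGE-B CHILD (κS-B₂²) `stub_U3_kappaSignCount2_typeTwo_mult`
(tree `Cruxes/H413/Lines/F0_P3c_DyRamFourFrame_U3_Laws.lean` ED. 13 :609), the type-2 twin of LH4-p04 (g3)'s (D) in KSB02-PAYER-PLAN v1 §2: TRUNK₂ ⊕ Ω-DICTIONARY ⊕ dead axis;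
dealer∕pen LH4-plan (g12) WORD #14 (1) «Type 2 (κS-B₂²) … say ✋», heir LEAD F0P3a-plan (g19) T18-53 ORDER OF SHAPE Q5 (one Ω factor for both vertex types)).  2026-09-04.
-/
import Summits.HodgeConjecture.HodgeConjecture.Theorems.F0P3cDyRamKappaCountTypeTwoSigned          -- ★ p857083 (LH4-p05 (g4)): (A₂) «κS-TRUNK, TYPE 2» `finsum_kappaCount_typeTwo_eq_token_mul_ampl`; brings ★ `exists_glue_witness`, ★ §P `isElementDatum_swap∕_rescale`, ★ parity
import Summits.HodgeConjecture.HodgeConjecture.Theorems.F0P3cDyRamDiagonalGlueSignTokenRotations    -- ★ p857107 (C1) (LH4-p04 (g3)): the foot∕slot Ω-dictionary `footZero∕One∕Two_slot_*`, `hCorner_slot`; brings ★ (C0) p857084 `…KappaCoreHangingOmega`, ★ p857033 `omegaR`, ★ p856992 `ampl_eq_zero_of_nonpos`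
import Summits.HodgeConjecture.HodgeConjecture.Theorems.F0P3cDyRamKappaSignCount2TypeZero           -- ★ p857128 (D) (LH4-p04 (g3)): §0 `exists_isGlueRep_of_le_depth` — «JUNK NEVER READ»: at depth `nᵢ ≥ 3d − 2` the read unit `(b, a, b∕a)_i` HAS a representative (REF5 R5-115 (2))
import HarnessLib

/-!
# Crux `H413`, line LH4 «(D-RAM) FOUR-FRAME» road — unit U3_Laws (iii), (KSS²) road: (D₂) THE (κS-B₂²) CHILD PAID —
# `Σᶠ_{M ∈ 𝓛₀(T), type-2-polarisable} κ₂,ᵢ(M)·w(M) = (Ω_i·w_i·baseSign_i·ω(fPartProd δ (a,b,1) i)) · ampl(q, k, B + τ(d))∕4` at the square datum, unconditionally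

Cell `hodgecm-mathlib` (D-0151), FLOOR 0, crux item H413 = `stmt-HodgeConjecture-24833`, route of record `HCCMUnconditional`; squad F0∕P3c∕LH4 (req618∕req620); registered stub
served: `F0P3cDyRamFourFrameU3.stub_U3_kappaSignCount2_typeTwo_mult` ((κS-B₂²), U3 ED. 13 «κS-RECUT (R-22)» :609 — the `hBκS20₂` binder of ★ p856996
`kappaSignModelSum2_of_kappaStageB_complete omegaR`).  THEOREMS ONLY (no `def`, no instance, no notation, no `sorry`, default heartbeats); lane
`--supports stmt-HodgeConjecture-24833 --as helper` (count-neutral).  ONE theorem, whose TYPE is the (κS-B₂²) sentence TOKEN FOR TOKEN (`[CompleteSpace K]`, `depthOfRecord d`,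
`shiftR d t`, `tauOfRecord d`, `omegaR`, `baseSign`, `fPartProd`, `ampl`).

THE MATHEMATICS (KSB02-PAYER-PLAN v1 §1, carried to vertex type 2 — the Ω factor is type-blind, T18-53 Q5 ∕ REF5 (g22) R5-115 (3)).
(1) TRUNK₂.  ★ `finsum_kappaCount_typeTwo_eq_token_mul_ampl` (p857083, LH4-p05 (g4)) evaluates the sum EXACTLY as `TOK · ampl(q, k, B + τ(d))∕4` at ANY three σ-fixed glue
witnesses `f₀, f₁, f₂` (★ `exists_glue_witness` on `hE`, on the swapped datum ★ `isElementDatum_swap hE`, on the rescaled datum ★ `isElementDatum_rescale hvσ hE`), `TOK` being the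
witness sign table: the equilateral H letters `(ω(−(1+f₀)), ω(f₀)ω(−(1+f₀)), ω(f₀))_i` on `n₁ = n₂ = n₃`, else the apex foot's glued letters `εG p i` (foot 0 `n₂ = n₃ < n₁` at `f₀`,
foot 1 `n₁ = n₃ < n₂` at `f₁`, foot 2 `n₁ = n₂ < n₃` at `f₂`).
(2) DEAD AXIS.  If `B + tauOfRecord d ≤ 0` both sides vanish (★ `ampl_eq_zero_of_nonpos`); the token — and the junk value of `Ω` on an axis without representative — is never read.
(3) ALIVE ⟹ PRECISION.  `2B = nᵢ − d + 2 − 2·shiftR d t`, `shiftR d t = d − d % 2`, `τ(d) = 1 − 2(d % 2)`, so `1 ≤ B + τ(d)` forces `nᵢ ≥ 3d − 2 + 2(d % 2) ≥ 3d − 2`: the READ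
axis carries the dictionary's depth.  Row by row ((C1)'s thresholds): the APEX slot of a foot needs the ABSOLUTE glue depth `2d − 1 ≤ n_apex − d + 1` (⟸ `n_apex ≥ 3d − 2`); a CROSS
slot needs the RELATIVE one `2d − 1 + (n_apex − n_cross) ≤ n_apex − d + 1` (⟸ `n_cross ≥ 3d − 2`, which is what the aliveness of THAT slot says); the H corner needs `2d − 1 ≤ n − d + 1`.
(3′) JUNK NEVER READ (heir LEAD T18-59 (b)(iv), strong form).  §1 `exists_isGlueRep_of_ampl_typeTwo_ne_zero`: a non-zero TYPE-2 amplitude forces the READ unit `(b, a, b∕a)_i` to HAVE a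
σ-fixed unit representative modulo `U_E^{(2d−1)}` (★ (D) p857128 §0 `exists_isGlueRep_of_le_depth` at the depth supplied by `le_depth_of_ampl_typeTwo_ne_zero`).
(4) DICTIONARY.  On the alive axis, shape by shape (★ `isoceles_of_isElementDatum`) and slot by slot (`fin_cases i`), LH4-p04 (g3)'s (C1) ★-bricks `footZero_slot_zero∕one∕two`,
`footOne_slot_zero∕one∕two`, `footTwo_slot_zero∕one∕two` and `hCorner_slot` (over LH4-p06 (g4)'s ★ (C0) p857084 representatives-from-the-witness and LH4-p04 (g2)'s ★ p856992
Ω-currency heads) rewrite `TOK_i` as `((omegaR K σ ϖ d a b i · ((ω(−1), ω(−1), 1)_i · (baseSign σ i · ω(fPartProd δ (a,b,1) i)))) : ℤ) : ℚ)` — the law token of :609.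
The root guards `|a − 1|, |b − 1| < |2|` of the sentence are IDLE here (plan §1 step 4: they serve the covered-set bridge `Ω ≡ 1` ★ p857007∕p857042, not the truth of :609).
So the U3 pay line of the next edition is the single token `Summit.HodgeConjecture.HodgeConjecture.Cruxes.H413.F0P3cDyRamKappaSignCount2TypeTwoMult.kappaSignCount2_typeTwo_mult`.
HONEST LABEL.  Count-neutral (`--supports`); this settles the RE-LETTERED SIGNED type-2 κ-census child of U3 — a kernel identity about the diagonal model (lattice counting, box
arithmetic, local norm-residue algebra), NOT a literature fact; with (D) the parent (KSS²) `stub_U3_kappaSignModelSum2` and (K-SGN-R2) `stub_U3_kappaSignLawR2` become sorry-free by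
composition in the next U3 edition; nothing printed is asserted; `HC_CM` is proved only modulo the 7 printed citations (2 remaining named inputs: hLiu418 = `stmt-HodgeConjecture-24832`,
h413 = `stmt-HodgeConjecture-24833`) until rung 0 closes.

## References
* [Kottwitz1986BaseChangeUnits] R. E. Kottwitz, *Base change for unit elements of Hecke algebras*, Compositio Math. 60 (1986), §1 pp. 240–241 (κ-orbital integrals of units as
  signed lattice counts modulo the torus).
* [Rogawski1990] J. D. Rogawski, *Automorphic Representations of Unitary Groups in Three Variables*, Ann. of Math. Stud. 123 (1990), §4.9 Prop. 4.9.1 (a) p. 55, §4.10 p. 58.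
* [LanglandsShelstad1987] R. P. Langlands, D. Shelstad, *On the definition of transfer factors*, Math. Ann. 278 (1987), §3 (κ as a character of `H¹(F, T)`).
* [Serre1979] J.-P. Serre, *Local Fields*, GTM 67 (1979), Ch. V §3 Prop. 5, Cor. 3 (deep one-units of the fixed field are norms: the Ω-dictionary's conductor bound).
-/

set_option autoImplicit false

noncomputable section

namespace Summit.HodgeConjecture.HodgeConjecture.Cruxes.H413.F0P3cDyRamKappaSignCount2TypeTwoMult

open Literature.NumberTheory.Automorphic Literature.NumberTheory.Automorphic.HermitianLattice
open Literature.NumberTheory.Automorphic.UnitaryLatticeTree Literature.NumberTheory.Automorphic.UnitaryThreeFourFrame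
open Literature.NumberTheory.LocalFields Literature.NumberTheory.LocalFields.WildQuadraticDatum
open Summit.HodgeConjecture.HodgeConjecture.Cruxes.H413.F0P3cDyRamFourFrameLawDefsR (shiftR)
open Summit.HodgeConjecture.HodgeConjecture.Cruxes.H413.F0P3cDyRamDiagonalTorusDefs
open Summit.HodgeConjecture.HodgeConjecture.Cruxes.H413.F0P3cDyRamDiagonalStrataDefs
open Summit.HodgeConjecture.HodgeConjecture.Cruxes.H413.F0P3cDyRamDiagonalKappaCountDefs
open Summit.HodgeConjecture.HodgeConjecture.Cruxes.H413.F0P3cDyRamElementDatumParity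
open Summit.HodgeConjecture.HodgeConjecture.Cruxes.H413.F0P3cDyRamDiagonalPermutation (isElementDatum_swap isElementDatum_rescale)
open Summit.HodgeConjecture.HodgeConjecture.Cruxes.H413.F0P3cDyRamKappaAssemblyTools (exists_glue_witness)
open Summit.HodgeConjecture.HodgeConjecture.Cruxes.H413.F0P3cDyRamKappaCountTypeTwoSigned (finsum_kappaCount_typeTwo_eq_token_mul_ampl)
open Summit.HodgeConjecture.HodgeConjecture.Cruxes.H413.F0P3cDyRamDiagonalGlueSignEval (ampl_eq_zero_of_nonpos)
open Summit.HodgeConjecture.HodgeConjecture.Cruxes.H413.F0P3cDyRamDiagonalGlueSignTokenRotations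
open Summit.HodgeConjecture.HodgeConjecture.Cruxes.H413.F0P3cDyRamOmegaRDefs (omegaR)
open Summit.HodgeConjecture.HodgeConjecture.Cruxes.H413.F0P3cDyRamDiagonalGlueSignDefs (IsGlueRep)
open Summit.HodgeConjecture.HodgeConjecture.Cruxes.H413.F0P3cDyRamKappaSignCount2TypeZero (exists_isGlueRep_of_le_depth)
open scoped Valued WithZero Matrix MatrixGroups

/-! ## §1  ALIVE ⟹ PRECISION (heir LEAD T18-59 (b)(iv)): the token is read only where the amplitude is non-zero, and there the read axis is `3d − 2` deep -/

/-- **A NON-ZERO AMPLITUDE HAS A POSITIVE EXPONENT: `ampl q k B ≠ 0 → 1 ≤ B`** (`q ≥ 1`) — the contrapositive of ★ `ampl_eq_zero_of_nonpos` (LH4-p04 (g2) p856992): the sign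
token multiplying `ampl` is READ only on an axis with `B ≥ 1`.  Type-blind (serves (D) at `B` and (D₂) at `B + tauOfRecord d`). [cite: Rogawski1990, §4.9 Prop. 4.9.1 (a) p. 55] -/
theorem one_le_of_ampl_ne_zero {q : ℕ} (hq : 1 ≤ q) (k : ℕ) {B : ℤ} (h : ampl q k B ≠ 0) : 1 ≤ B := by
  by_contra hB
  exact h (ampl_eq_zero_of_nonpos hq k (by omega))

/-- **ALIVE ⟹ PRECISION AT VERTEX TYPE 2** (KSB02-PAYER-PLAN v1 §1 step 3 at type 2; REF5 (g22) R5-115 (2) «a glue representative exists ⟺ nᵢ ≥ 3d − 2»): under the re-cut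
parity datum `2B = n − d + 2 − 2·shiftR d t` (`shiftR d t = d − d % 2`), a NON-ZERO type-2 amplitude `ampl q k (B + tauOfRecord d) ≠ 0` (`tauOfRecord d = 1 − 2(d % 2)`) forces the
read axis to depth `n ≥ 3d − 2 + 2(d % 2)` — `3d − 2` ON THE NOSE at even `d`, `3d` at odd `d` — hence `≥ 3d − 2`, the level at which (C0)∕(C1) read `Ω` at the witness's own
representative; so the junk value `Ω := 1` of an axis WITHOUT representative is multiplied by `ampl = 0` and never read. [cite: Rogawski1990, §4.9 Prop. 4.9.1 (a) p. 55, §4.10 p. 58] [cite: Serre1979, Ch. V §3 Prop. 5, Cor. 3] -/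
theorem le_depth_of_ampl_typeTwo_ne_zero {q : ℕ} (hq : 1 ≤ q) (k : ℕ) {d t n : ℕ} {B : ℤ}
    (hB : 2 * B = (n : ℤ) - d + 2 - 2 * shiftR d t) (h : ampl q k (B + tauOfRecord d) ≠ 0) : 3 * d - 2 + 2 * (d % 2) ≤ n := by
  have h1 := one_le_of_ampl_ne_zero hq k h
  have hshift : shiftR d t = ((d - d % 2 : ℕ) : ℤ) := rfl
  have hτ : tauOfRecord d = 1 - 2 * ((d % 2 : ℕ) : ℤ) := by
    unfold tauOfRecord
    rcases Nat.mod_two_eq_zero_or_one d with hε | hε <;> simp [hε]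
  rw [hshift] at hB
  rw [hτ] at h1
  have hd2' : d % 2 < 2 := Nat.mod_lt d (by norm_num)
  have hdd : d % 2 ≤ d := Nat.mod_le d 2
  omega

/-- **ALIVE AT VERTEX TYPE 2 ⟹ THE READ UNIT HAS A REPRESENTATIVE («JUNK NEVER READ», heir LEAD T18-59 (b)(iv) in its strong form, the type-2 twin of (D) §0
`exists_isGlueRep_of_ampl_ne_zero`).**  At a wild ramified quadratic datum, for the square element datum `(a², b²; n₁, n₂, n₃)` at the depth of record, a slot `i` and the re-cut parity
datum `2B = nᵢ − d + 2 − 2·shiftR d t`: if the TYPE-2 amplitude `ampl q k (B + tauOfRecord d)` is non-zero, the unit `(b, a, b∕a)_i` of axis `i` HAS a σ-fixed unit representative modulo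
`U_E^{(2d−1)}` — so `omegaR K σ ϖ d a b i = glueSign σ ϖ d ((b, a, b∕a)_i)` is an honest norm class (★ `glueSign_eq_normSign`) wherever the head below reads it, and the junk value `1`
of `glueSign` on an axis WITHOUT representative is only ever multiplied by `ampl = 0`.  := `le_depth_of_ampl_typeTwo_ne_zero` ⊕ (D) §0 `exists_isGlueRep_of_le_depth` (LH4-p04 (g3)).
NB the type-0 corollary cannot serve here: at even `d` the boundary `nᵢ = 3d − 2` has `B = 0` (type-0 DEAD) but `B + τ(d) = 1` (type-2 ALIVE).
[cite: Serre1979, Ch. V §3 Prop. 5, Cor. 3] [cite: Rogawski1990, §4.9 Prop. 4.9.1 (a) p. 55, §4.10 p. 58] -/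
theorem exists_isGlueRep_of_ampl_typeTwo_ne_zero
    {K : Type} [Field K] [Valued K ℤᵐ⁰] [CompleteSpace K] [Fintype 𝓀[K]] {σ : K →+* K} {ϖ : K} {d t : ℕ} (hD : IsRamifiedQuadraticDatum σ ϖ d t)
    {a b : K} (ha : a * σ a = 1) (hb : b * σ b = 1) {n₁ n₂ n₃ : ℕ} (hE : IsElementDatum σ ϖ (depthOfRecord d) (a * a) (b * b) n₁ n₂ n₃)
    (k : ℕ) (i : Fin 3) (B : ℤ) (hB : 2 * B = ((![n₁, n₂, n₃] : Fin 3 → ℕ) i : ℤ) - d + 2 - 2 * shiftR d t) (hampl : ampl (Fintype.card 𝓀[K]) k (B + tauOfRecord d) ≠ 0) :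
    ∃ u : K, IsGlueRep σ ϖ d ((![b, a, b / a] : Fin 3 → K) i) u :=
  exists_isGlueRep_of_le_depth hD ha hb hE i (by have h := le_depth_of_ampl_typeTwo_ne_zero Fintype.card_pos k hB hampl; omega)

/-! ## §2  The (κS-B₂²) child, unconditionally -/

/-- **(κS-B₂²) «TYPE 2, SIGNED, RE-LETTERED AT THE SCHEDULE OF RECORD, WITH MULTIPLICITY» — THE Ω-AWARE SIGNED κ-WEIGHTED TYPE-2 CENSUS LAW OF THE DIAGONAL MODEL.**  For every
wild ramified quadratic datum on a complete field with finite residue field (`|2| < 1`), a skew `δ ≠ 0`, norm-one roots `a, b` (root guard `|a − 1|, |b − 1| < |2|`, idle), the square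
element datum `(a², b²; n₁, n₂, n₃)` at the depth of record, `T = diag(a², b², 1)`, `2k + d = n₁ + n₂ + n₃ + 2`, every slot `i` and `2B = nᵢ − d + 2 − 2·shiftR d t`:
`Σᶠ_{M ∈ 𝓛₀(T), type-2-polarisable} κ₂,ᵢ(M)·w(M) = (omegaR K σ ϖ d a b i · (ω(−1), ω(−1), 1)_i · baseSign σ i · ω(fPartProd δ (a,b,1) i)) · ampl(q, k, B + τ(d))∕4` — the sentence of
`stub_U3_kappaSignCount2_typeTwo_mult` (U3 ED. 13 :609) TOKEN FOR TOKEN: ★ TRUNK₂ `finsum_kappaCount_typeTwo_eq_token_mul_ampl` at the three ★ glue witnesses, then on the dead axis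
(`ampl = 0`) nothing is read, on the alive axis §1 `le_depth_of_ampl_typeTwo_ne_zero` (ALIVE ⟹ PRECISION, `nᵢ ≥ 3d − 2 + 2(d % 2)`) feeds the (C1) foot∕slot Ω-dictionary.
[cite: Kottwitz1986BaseChangeUnits, §1 pp. 240–241] [cite: Rogawski1990, §4.9 Prop. 4.9.1 (a) p. 55; §4.10 p. 58] [cite: LanglandsShelstad1987, §3] [cite: Serre1979, Ch. V §3 Prop. 5, Cor. 3] -/
theorem kappaSignCount2_typeTwo_mult :
    ∀ {K : Type} [Field K] [Valued K ℤᵐ⁰] [CompleteSpace K] [Fintype 𝓀[K]] {σ : K →+* K} {ϖ : K} {d t : ℕ}, IsRamifiedQuadraticDatum σ ϖ d t →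
      Valued.v (2 : K) < 1 → ∀ {δ : K}, σ δ = -δ → δ ≠ 0 →
      ∀ {a b : K}, a * σ a = 1 → b * σ b = 1 → Valued.v (a - 1) < Valued.v (2 : K) → Valued.v (b - 1) < Valued.v (2 : K) →
      ∀ {n₁ n₂ n₃ : ℕ}, IsElementDatum σ ϖ (depthOfRecord d) (a * a) (b * b) n₁ n₂ n₃ →
      ∀ (T : GL (Fin 3) K), (T : Matrix (Fin 3) (Fin 3) K) = Matrix.diagonal ![a * a, b * b, 1] → ∀ (k : ℕ), 2 * k + d = n₁ + n₂ + n₃ + 2 →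
      ∀ (i : Fin 3) (B : ℤ), 2 * B = ((![n₁, n₂, n₃] : Fin 3 → ℕ) i : ℤ) - d + 2 - 2 * shiftR d t →
        ∑ᶠ M ∈ {M : Submodule 𝒪[K] (Fin 3 → K) | M ∈ normalisedStableLattices T ∧ IsTypeTwoPolarisable σ ϖ M},
            (kappaCount σ ϖ 2 i M : ℚ) * stabiliserWeight σ M =
          ((omegaR K σ ϖ d a b i * ((![normSign σ (-1 : K), normSign σ (-1 : K), 1] : Fin 3 → ℤ) i *
            (baseSign σ i * normSign σ (fPartProd δ ![a, b, 1] i))) : ℤ) : ℚ) * ampl (Fintype.card 𝓀[K]) k (B + tauOfRecord d) / 4 := by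
  intro K _ _ _ _ σ ϖ d t hD h2 δ hδ hδ0 a b ha hb _ _ n₁ n₂ n₃ hE T hT k hk i B hB
  have hvσ : ∀ x, Valued.v (σ x) = Valued.v x := hD.2.1
  have hN₀ : d ≤ depthOfRecord d := by unfold depthOfRecord; split_ifs <;> omega
  -- (1) the three ★ glue witnesses and TRUNK₂
  obtain ⟨f₀, hσf₀, hf₀⟩ := exists_glue_witness hD hE hN₀
  obtain ⟨f₁, hσf₁, hf₁⟩ := exists_glue_witness hD (isElementDatum_swap hE) hN₀
  obtain ⟨f₂, hσf₂, hf₂⟩ := exists_glue_witness hD (isElementDatum_rescale hvσ hE) hN₀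
  rw [finsum_kappaCount_typeTwo_eq_token_mul_ampl hD h2 hE T hT k hk i B hB hσf₀ hσf₁ hσf₂ hf₀ hf₁ hf₂]
  -- (2) the DEAD axis: the amplitude vanishes on both sides and the token is not read
  by_cases hdead : ampl (Fintype.card 𝓀[K]) k (B + tauOfRecord d) = 0
  · rw [hdead]
    simp
  -- (3) the ALIVE axis: ALIVE ⟹ PRECISION (§1) — the read axis is `3d − 2 + 2(d % 2)` deep — and only the token is left to compare
  have hnᵢ : 3 * d - 2 + 2 * (d % 2) ≤ (![n₁, n₂, n₃] : Fin 3 → ℕ) i := le_depth_of_ampl_typeTwo_ne_zero Fintype.card_pos k hB hdead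
  simp only [mul_div_assoc]
  congr 1
  obtain ⟨-, -, -, -, -, h₁, h₂, h₃, -, -, -⟩ := id hE
  have hiso := isoceles_of_isElementDatum hD hE
  -- (4) the dictionary, shape by shape and slot by slot: ONE (C1) brick per cell, its level side-goal from `hnᵢ`
  by_cases heq : n₁ = n₂ ∧ n₂ = n₃
  · -- the H corner `n₁ = n₂ = n₃`, witness `f₀`
    rw [if_pos heq]
    obtain ⟨h12, h23⟩ := heq
    have hn : 3 * d - 2 + 2 * (d % 2) ≤ n₁ := by fin_cases i <;> simp at hnᵢ <;> omega
    subst h23; subst h12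
    exact hCorner_slot hD hδ hδ0 ha hb h₁ h₂ h₃ hσf₀ (hf₀ rfl le_rfl) (by omega) i
  by_cases h23 : n₂ = n₃
  · -- foot 0: `n₂ = n₃ < n₁`, apex slot `0`, witness `f₀`
    rw [if_neg heq, if_pos h23]
    have h21 : n₂ ≤ n₁ := by rcases hiso with h | h | h <;> omega
    fin_cases i
    · have hn : 3 * d - 2 + 2 * (d % 2) ≤ n₁ := by simpa using hnᵢ
      exact footZero_slot_zero hD hδ hδ0 ha hb h₁ h₂ h₃ h23 hσf₀ (hf₀ h23 h21) (by omega)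
    · have hn : 3 * d - 2 + 2 * (d % 2) ≤ n₂ := by simpa using hnᵢ
      exact footZero_slot_one hD hδ hδ0 ha hb h₁ h₂ h₃ h23 h21 hσf₀ (hf₀ h23 h21) (by omega)
    · have hn : 3 * d - 2 + 2 * (d % 2) ≤ n₃ := by simpa using hnᵢ
      exact footZero_slot_two hD hδ hδ0 ha hb h₁ h₂ h₃ h21 hσf₀ (hf₀ h23 h21) (by omega)
  by_cases h13 : n₁ = n₃
  · -- foot 1: `n₁ = n₃ < n₂`, apex slot `1`, witness `f₁` of the swapped datum `(b, a)`
    rw [if_neg heq, if_neg h23, if_pos h13]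
    have h12 : n₁ ≤ n₂ := by rcases hiso with h | h | h <;> omega
    fin_cases i
    · have hn : 3 * d - 2 + 2 * (d % 2) ≤ n₁ := by simpa using hnᵢ
      exact footOne_slot_zero hD hδ hδ0 ha hb h₁ h₂ h₃ h13 h12 hσf₁ (hf₁ h13 h12) (by omega)
    · have hn : 3 * d - 2 + 2 * (d % 2) ≤ n₂ := by simpa using hnᵢ
      exact footOne_slot_one hD hδ hδ0 ha hb h₁ h₂ h₃ h13 hσf₁ (hf₁ h13 h12) (by omega)
    · have hn : 3 * d - 2 + 2 * (d % 2) ≤ n₃ := by simpa using hnᵢ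
      exact footOne_slot_two hD hδ hδ0 ha hb h₁ h₂ h₃ h12 hσf₁ (hf₁ h13 h12) (by omega)
  · -- foot 2: `n₁ = n₂ < n₃`, apex slot `2`, witness `f₂` of the rescaled datum `(a⁻¹, b·a⁻¹)`
    rw [if_neg heq, if_neg h23, if_neg h13]
    have h12 : n₁ = n₂ := by rcases hiso with h | h | h <;> omega
    have h23' : n₂ ≤ n₃ := by rcases hiso with h | h | h <;> omega
    fin_cases i
    · have hn : 3 * d - 2 + 2 * (d % 2) ≤ n₁ := by simpa using hnᵢ
      exact footTwo_slot_zero hD hδ hδ0 ha hb h₁ h₂ h₃ h23' hσf₂ (hf₂ h12.symm h23') (by omega)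
    · have hn : 3 * d - 2 + 2 * (d % 2) ≤ n₂ := by simpa using hnᵢ
      exact footTwo_slot_one hD hδ hδ0 ha hb h₁ h₂ h₃ h12 h23' hσf₂ (hf₂ h12.symm h23') (by omega)
    · have hn : 3 * d - 2 + 2 * (d % 2) ≤ n₃ := by simpa using hnᵢ
      exact footTwo_slot_two hD hδ hδ0 ha hb h₁ h₂ h₃ h12 hσf₂ (hf₂ h12.symm h23') (by omega)

end Summit.HodgeConjecture.HodgeConjecture.Cruxes.H413.F0P3cDyRamKappaSignCount2TypeTwoMult

end
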